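import Summits.Ventures.PackingBounds.ThreePointCert.Check

/-!
# X2 cap cut `X2D8u0605` (u₀ = -121/200, degrees (d, d_X) = (8, 8)): certificate data, leaf part 9

HONEST FRAMING: generated data / kernel-validation file of the venture `Crystal3D` (cell `pub-crystal3d`, phase 2,
seat p2): one piece of the kernel replay of an EXACT pole-augmented («X2») Bachoc–Vallentin cap certificate on `S²`
(format `Bulk/CapX2Cert.X2Cert` of seat p1; cap level u₀ = -121/200, inner products ≤ 1/2) solved directly in
sum-of-squares form (`capx2sos.py` + `exactx2.py`: CLARABEL float solve → exact rounding → integer identities; certificate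
`x2sos_d8_dX8_u121over200`, bound value 11.999407 < 12) and checked through `TopCut/X2SOSExpand.lean` + `X2SOSCheck.lean` +
`X2SOSSound.lean` (generic checker + soundness), `TopCut/CapSOSCheck.lean` and the tree's `ThreePointCert.CheckKron`.
Nothing geometric is proved in this file; plain lists of integers / rationals / monomials and `decide +kernel` facts about
them (standard axioms only, no `native_decide`).
-/

namespace Summit.Ventures.Crystal3D.TopCut.X2D8u0605

open Literature.Geometry.DiscreteGeometry Literature.Geometry.DiscreteGeometry.PolyCert PolyCert.SPoly
open Summit.Ventures.PackingBounds.ThreePointCert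

/-- Integer pole columns `Φᵇ_{6,r}`. [folklore] -/
def phiB6 : List (List ℤ) := [[-83833331227, -162810484680, 96410179052], [-117852445, -1549166902, 616316872], [-259964183, 289197775, 3001341358], [-775875, -1116098567, 2020633672], [368060922, 1000658577, -736121844], [-38153894, 0, 76307788]]

/-- Monomial row basis of pole block `7`: `g_{7,i}(x) = x^i`, `i ≤ 1`. [folklore] -/
def wx7 : List (List ℚ) := [[1], [0, 1]]

/-- Pole factor half `M1_7[i][r] = Φᵃ_{7,r}[i]/N_7`. [folklore] -/
def mA7 : List (List ℚ) :=
  [[1793873205/549755813888, 0, 0, 0], [(-122271982989/549755813888), 1593932427/549755813888, 0, 0]]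

/-- Pole factor half `M2_7[i][r] = Φᵇ_{7,r}[i]/N_7`. [folklore] -/
def mB7 : List (List ℚ) :=
  [[2937072709/549755813888, (-401175495/1099511627776), 19218727/137438953472, 0], [50277417133/1099511627776, (-523483287/1099511627776), 1605433979/1099511627776, 83721135/1099511627776]]

/-- Integer pole columns `Φᵃ_{7,r}`. [folklore] -/
def phiA7 : List (List ℤ) := [[3587746410, -244543965978], [0, 3187864854], [0, 0], [0, 0]]

/-- Integer pole columns `Φᵇ_{7,r}`. [folklore] -/
def phiB7 : List (List ℤ) := [[5874145418, 50277417133], [-401175495, -523483287], [153749816, 1605433979], [0, 83721135]]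

/-- Monomial row basis of pole block `8`: `g_{8,i}(x) = x^i`, `i ≤ 0`. [folklore] -/
def wx8 : List (List ℚ) := [[1]]

/-- Pole factor half `M1_8[i][r] = Φᵃ_{8,r}[i]/N_8`. [folklore] -/
def mA8 : List (List ℚ) :=
  [[21217007/549755813888, 0]]

/-- Pole factor half `M2_8[i][r] = Φᵇ_{8,r}[i]/N_8`. [folklore] -/
def mB8 : List (List ℚ) :=
  [[(-330471825/1099511627776), 8636045/1099511627776]]

/-- Integer pole columns `Φᵃ_{8,r}`. [folklore] -/
def phiA8 : List (List ℤ) := [[42434014], [0]]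

/-- Integer pole columns `Φᵇ_{8,r}`. [folklore] -/
def phiB8 : List (List ℤ) := [[-330471825], [8636045]]

end Summit.Ventures.Crystal3D.TopCut.X2D8u0605
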